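import Summits.Ventures.DiscreteObjects.MOLS.IsMOLSComplete
import Summits.Ventures.DiscreteObjects.MOLS.NetCompletionTwo

/-!
# Target (M-b) as a nine-square certificate statement (kernel glue)
Framing: lottery ticket; floor = certified bounds/negative ranges.

Cell pub-namedobj (venture DiscreteObjects), target (M), designs gen 9.  Composition of `existsPlaneOrder12_iff_nine_MOLS`
(Shrikhande + Bose, `NetCompletionTwo`) with the checker equivalence `exists_MOLS_iff_certificate` (`IsMOLSComplete`):
**`existsPlaneOrder12_iff_nine_certificate`** — a projective plane of order 12 exists iff some list of NINE squares with 12 rows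
each passes verify-ref's Bool checker `isMOLS`; and the general form **`existsPlane_iff_certificate`** (`5 ≤ n`: a projective
plane of order `n` exists iff some list of `n - 3` squares with `n` rows passes `isMOLS`).  HIT protocol, final form:
`existsPlaneOrder12_of_nine_isMOLS`.  Glue only; no `sorry`.
-/

namespace Summit.Ventures.DiscreteObjects.MOLS

open Summit.Ventures.DiscreteObjects.Verify

/-- **PP(12) ⇔ a nine-square certificate.** -/
theorem existsPlaneOrder12_iff_nine_certificate :
    ExistsProjectivePlaneOrder12 ↔
      ∃ Ls : List (List (List ℕ)), Ls.length = 9 ∧ (∀ L ∈ Ls, L.length = 12) ∧ isMOLS Ls = true :=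
  existsPlaneOrder12_iff_nine_MOLS.trans (exists_MOLS_iff_certificate 9 12)

/-- **HIT protocol (M-b), final form:** nine squares of order 12 passing `isMOLS` prove `ExistsProjectivePlaneOrder12`. -/
theorem existsPlaneOrder12_of_nine_isMOLS (Ls : List (List (List ℕ))) (h9 : Ls.length = 9) (hlen : ∀ L ∈ Ls, L.length = 12)
    (h : isMOLS Ls = true) : ExistsProjectivePlaneOrder12 :=
  existsPlaneOrder12_iff_nine_certificate.2 ⟨Ls, h9, hlen, h⟩

/-- **PP(n) ⇔ an `(n-3)`-square certificate**, every `n ≥ 5`. -/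
theorem existsPlane_iff_certificate {n : ℕ} (hn : 5 ≤ n) :
    ExistsProjectivePlaneOrder n ↔
      ∃ Ls : List (List (List ℕ)), Ls.length = n - 3 ∧ (∀ L ∈ Ls, L.length = n) ∧ isMOLS Ls = true :=
  (existsPlane_iff_MOLS_deficiency_two hn).trans (exists_MOLS_iff_certificate (n - 3) n)

end Summit.Ventures.DiscreteObjects.MOLS
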